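import Summits.BirchSwinnertonDyer.Rank1Residual.GaloisImage.KolyvaginScalarTransportLocal
import Summits.BirchSwinnertonDyer.Rank1Residual.GaloisImage.KolyvaginLedgerAlgebra
import HarnessLib

/-!
# Scalar transport between two Kolyvagin levels, II: `ord₃ a = ord₃ a′` through a core vertex
# (cell `b2b-bsdres`, team n1011, ROUTE-1 item R1-23 (a′) — skeleton `cells/n1011/skel/T-R1-23.md`
# (n1011-p18) §2 S2–S3, file F-tr (seat p11); part 2 of 2 — END SHAPE `Transport.pow_dvd_iff_of_comp`
# as agreed with the R1-23 assembler n1011-p18, INBOX 2026-08-21 11:09Z / 11:24Z)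

HONEST FRAMING (verbatim for the cell): research route; prove what is provable now; no claim beyond
stated classes; nothing booked; no mark / label moved.  TOOL theorem; no definition, no named fact;
Sakamoto's Thm. 4.4 (2) (ORDER form, R1-22) and the Poitou–Tate pair count enter as HYPOTHESES at
both depths (discharged elsewhere: `Sakamoto2024KolyvaginFittingIdeal` / F-deep + M2′), never asserted.

## The argument (Mazur–Rubin, *Kolyvagin systems*, Thm. 4.4.1-style rigidity, two depths `k ≤ k'`)

`g'` generates `KS₁(E[3^{k'+1}], 𝓕_can, 𝒫')` (additive order `3^{k'+1}`), `g ∈ KS₁(E[3^{k+1}], …)`.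
S2: some coordinate `g'_{d₀}` has order `3^{k'+1}` (`Ledger.exists_addOrderOf_apply_eq_pow`), so
`d₀` is a level and Thm. 4.4 (2) forces `#N_{d₀}(k') = 1` (`natCard_eq_one_of_order_clauses`: the
dual Selmer group is killed by `3^{k'+1}`, hence has `3`-power order, and neither clause allows
more); the pair count makes `H' = H¹_{𝓕'(d₀)}(ℚ, E[3^{k'+1}])` CYCLIC of order `3^{k'+1}`.
S3: `incl_*` embeds `H = H¹_{𝓕(d₀)}(ℚ, E[3^{k+1}])` into `H'` (part I, (L1)+(L2), `E(ℚ)[3] = 0` from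
`surj(3)`), `H` is killed by `3^{k+1}`, so `#H ∣ 3^{k+1}` and the pair count at depth `k` gives
`#N_{d₀}(k) = 1` (`eq_one_of_injective_of_isAddCyclic`), whence `g_{d₀}` has order `3^{k+1} = #H`
(Thm. 4.4 (2) at depth `k`) and generates `H`; `red_* g'_{d₀} ∈ H` (L3) is `w • g_{d₀}` with `3 ∤ w`
(`incl_* red_* = 3^{k'−k}`, (L4), `Ledger.not_dvd_of_comp_eq_pow_nsmul`); finally
`red_* (a' • g'_{d₀}) = a • g_{d₀}` reads `(a' w) • g_{d₀} = a • g_{d₀}` and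
`Ledger.pow_dvd_iff_of_mul_nsmul_eq_nsmul` gives `3^s ∣ a ↔ 3^s ∣ a'` for `s ≤ k + 1`.

## Hypothesis ledger of `pow_dvd_iff_of_comp` (every binder is used; none is a minted fact)

`hk`; the two `Finite (geomTorsion …)` instances (the Tate duals exist); `D`, `D'`, `red`, `hred`
(R1-21₂ convention); `hsurj` (`E(ℚ)[3^∞] = 0`); `hT`, `hT'` (cyclotomic transverse conditions —
functorial in the coefficients); `hPP : D'.primes ⊆ D.primes` (common levels); `inv`, `inv'` (the
Poitou–Tate families at moduli `3^{k+1}`, `3^{k'+1}` — only through `hR22*`/`hPT*`); `hg`, `hg'`,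
`hgo'` (generator data in the output shape of `Ledger.exists_mem_generator_of_isFreeRankOneZMod`;
the order of `g` is NOT assumed — it is recovered at `d₀`); `hR22`, `hR22'` (Thm. 4.4 (2), ORDER
form, literal two-clause shape of `Sakamoto2024.kolyvaginSystems_idealOfBasis_eq_fittingIdeal_zmod_three_pow`);
`hPT`, `hPT'` (pair counts `#H¹_{𝓕(d)} = 3^{K}·#N_d`); `hκ'`, `hκu'`, `hcomp` (Kato's classes at the
two depths and their compatibility under `red`, R1-21₂ (COMP)).
-/

noncomputable section

open scoped Classical NumberField ContRepresentation
open Function Field NumberField IsDedekindDomain WeierstrassCurve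
open Literature.NumberTheory.EllipticCurves
open Literature.NumberTheory.GaloisRepresentations Literature.NumberTheory.GaloisRepresentations.DiscreteGaloisModule
  Literature.NumberTheory.GaloisCohomology

namespace Summit.BirchSwinnertonDyer.Rank1Residual.GaloisImage.Transport

/-! ## Abstract finite-group steps (orders, counts, generators) -/

section Algebra

variable {p : ℕ} [hp : Fact p.Prime]

/-- A finite additive group killed by `p^K` has order a power of `p` (`IsPGroup.iff_card` on the
multiplicative copy). [folklore] -/
theorem exists_natCard_eq_pow_of_nsmul_eq_zero {X : Type*} [AddCommGroup X] [Finite X] {K : ℕ}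
    (hexp : ∀ x : X, p ^ K • x = 0) : ∃ j, Nat.card X = p ^ j := by
  have hG : IsPGroup p (Multiplicative X) := fun g =>
    ⟨K, by rw [← ofAdd_toAdd g, ← ofAdd_nsmul, hexp, ofAdd_zero]⟩
  obtain ⟨n, hn⟩ := IsPGroup.iff_card.mp hG
  exact ⟨n, hn⟩

/-- **Core vertex at the deep level** (skeleton S2): if `y` (`= g'_{d₀}`) has additive order `p^K`,
`K ≥ 1`, the group `N` (`= N_{d₀}`) is killed by `p^K`, and the two clauses of the ORDER form of
Sakamoto's Thm. 4.4 (2) hold (`#N ∣ p^K ⟹ ord(y)·#N = p^K`; `p^K ∣ #N ⟹ y = 0`), then `#N = 1`.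
[cite: Sakamoto2024, Thm. 4.4 (2) (p. 926)] -/
theorem natCard_eq_one_of_order_clauses {B N : Type*} [AddGroup B] [AddCommGroup N] (y : B)
    {K : ℕ} (hK : 0 < K) (hy : addOrderOf y = p ^ K) (hexp : ∀ n : N, p ^ K • n = 0)
    (h1 : Nat.card N ∣ p ^ K → addOrderOf y * Nat.card N = p ^ K)
    (h2 : p ^ K ∣ Nat.card N → y = 0) : Nat.card N = 1 := by
  have hpK : 1 < p ^ K := Nat.one_lt_pow hK.ne' hp.out.one_lt
  have hnd : ¬ p ^ K ∣ Nat.card N := fun h => by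
    have h0 := h2 h
    rw [h0, addOrderOf_zero] at hy
    omega
  have hc0 : Nat.card N ≠ 0 := fun h => hnd (h ▸ dvd_zero _)
  haveI : Finite N := Nat.finite_of_card_ne_zero hc0
  obtain ⟨j, hj⟩ := exists_natCard_eq_pow_of_nsmul_eq_zero (p := p) hexp
  have hjK : j < K := by
    by_contra hle
    exact hnd (hj ▸ pow_dvd_pow p (not_lt.mp hle))
  have h := h1 (hj ▸ pow_dvd_pow p hjK.le)
  rw [hy] at h
  have hpos : 0 < p ^ K := pow_pos hp.out.pos K
  nlinarith [Nat.one_le_iff_ne_zero.mpr hc0]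

omit hp in
/-- **Counting through an injection into a cyclic group** (skeleton S3, level `k`): an additive group
`H` killed by `p^K`, embedded in a finite cyclic group, with `#H = p^K · N`, has `N = 1`
(`H` is cyclic, generated by an element of order `∣ p^K`). [folklore] -/
theorem eq_one_of_injective_of_isAddCyclic {H H' : Type*} [AddCommGroup H] [AddCommGroup H']
    [Finite H'] [IsAddCyclic H'] (f : H →+ H') (hf : Function.Injective f) {K N : ℕ}
    (hexp : ∀ h : H, p ^ K • h = 0) (hcard : Nat.card H = p ^ K * N) (hp0 : 0 < p) : N = 1 := by
  haveI : Finite H := Finite.of_injective f hf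
  haveI : IsAddCyclic H := isAddCyclic_of_injective f hf
  obtain ⟨z, hz⟩ := IsAddCyclic.exists_ofOrder_eq_natCard (α := H)
  have hdvd : Nat.card H ∣ p ^ K := hz ▸ addOrderOf_dvd_of_nsmul_eq_zero (hexp z)
  have hc0 : Nat.card H ≠ 0 := Nat.card_pos.ne'
  rw [hcard] at hdvd hc0
  have hle := Nat.le_of_dvd (pow_pos hp0 K) hdvd
  have hN0 : N ≠ 0 := fun h => hc0 (by rw [h, mul_zero])
  have hN1 : N ≤ 1 := Nat.le_of_mul_le_mul_left (by simpa using hle) (pow_pos hp0 K)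
  omega

omit hp in
/-- In a subgroup `H` of order `addOrderOf x` with `x ∈ H`, every `y ∈ H` is a natural multiple of
`x`. [folklore] -/
theorem exists_nsmul_eq_of_addOrderOf_eq_natCard {G : Type*} [AddCommGroup G] (H : AddSubgroup G)
    [Finite H] {x y : G} (hx : x ∈ H) (hy : y ∈ H) (hord : addOrderOf x = Nat.card H) :
    ∃ w : ℕ, w • x = y := by
  have htop : AddSubgroup.zmultiples (⟨x, hx⟩ : H) = ⊤ := by
    apply AddSubgroup.eq_top_of_card_eq
    rw [Nat.card_zmultiples, ← hord, AddSubgroup.addOrderOf_mk]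
  have hmem : (⟨y, hy⟩ : H) ∈ AddSubgroup.zmultiples (⟨x, hx⟩ : H) := htop ▸ AddSubgroup.mem_top _
  obtain ⟨z, hz⟩ := AddSubgroup.mem_zmultiples_iff.mp hmem
  have hz' : z • x = y := by simpa using congrArg Subtype.val hz
  have hfin : IsOfFinAddOrder x := by
    rw [← addOrderOf_pos_iff, hord]
    exact Nat.card_pos
  have hmem' : y ∈ AddSubmonoid.multiples x :=
    (hfin.mem_multiples_iff_mem_zmultiples).mpr (AddSubgroup.mem_zmultiples_iff.mpr ⟨z, hz'⟩)
  exact (AddSubmonoid.mem_multiples_iff _ _).mp hmem'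

end Algebra

/-- **Scalar transport at a core vertex** (Mazur–Rubin Thm. 4.4.1-style; skeleton T-R1-23 S2–S3):
two depths `k ≤ k'`, Kolyvagin data `D` on `E[3^{k+1}]` and `D'` on `E[3^{k'+1}]` with `D'.primes ⊆
D.primes` and cyclotomic transverse conditions, THE reduction `red : E[3^{k'+1}] → E[3^{k+1}]`
(`x ↦ 3^{k'−k} x` on points), `surj(3)`, Kolyvagin systems `g`, `g'` at the two depths with `g'`
of additive order `3^{k'+1}`, the ORDER form of Sakamoto's Thm. 4.4 (2) and the Poitou–Tate pair
count at both depths as hypotheses, and two systems `κ' = a • g`, `κu' = a' • g'` with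
`red_* (κu' d) = κ' d` on common levels: then `3^s ∣ a ↔ 3^s ∣ a'` for every `s ≤ k + 1`.
[cite: MazurRubin2004, Thm. 4.4.1 (p. 45)] [cite: Sakamoto2024, Thm. 4.4 (p. 926)] -/
theorem pow_dvd_iff_of_comp (W : WeierstrassCurve ℚ) [W.IsElliptic]
    {k k' : ℕ} (hk : k ≤ k')
    [Finite (geomTorsion W (((3 : ℕ) : ℤ) ^ k * ((3 : ℕ) : ℤ)))]
    [Finite (geomTorsion W (((3 : ℕ) : ℤ) ^ k' * ((3 : ℕ) : ℤ)))]
    (D : KolyvaginDatum (W.torsionGaloisModule (((3 : ℕ) : ℤ) ^ k * ((3 : ℕ) : ℤ))))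
    (D' : KolyvaginDatum (W.torsionGaloisModule (((3 : ℕ) : ℤ) ^ k' * ((3 : ℕ) : ℤ))))
    (red : (W.torsionGaloisModule (((3 : ℕ) : ℤ) ^ k' * ((3 : ℕ) : ℤ))).toContRepresentation →ⁱL
      (W.torsionGaloisModule (((3 : ℕ) : ℤ) ^ k * ((3 : ℕ) : ℤ))).toContRepresentation)
    (hred : ∀ x : geomTorsion W (((3 : ℕ) : ℤ) ^ k' * ((3 : ℕ) : ℤ)),
      ((red x : geomTorsion W (((3 : ℕ) : ℤ) ^ k * ((3 : ℕ) : ℤ))) : geomPoints W) =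
        (((3 : ℕ) : ℤ) ^ (k' - k)) • (x : geomPoints W))
    (hsurj : W.HasSurjectiveModNGaloisRep ((3 : ℕ) : ℤ))
    (hT : D.transverse = cyclotomicTransverse _) (hT' : D'.transverse = cyclotomicTransverse _)
    (hPP : D'.primes ⊆ D.primes)
    (inv : LocalInvariants ℚ (3 ^ (k + 1))) (inv' : LocalInvariants ℚ (3 ^ (k' + 1)))
    -- Kolyvagin systems at the two depths, `g'` a generator (output shape of
    -- `Ledger.exists_mem_generator_of_isFreeRankOneZMod`); the order of `g` is recovered at `d₀`
    {g : Finset (HeightOneSpectrum (𝓞 ℚ)) →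
      galoisCohomology (W.torsionGaloisModule (((3 : ℕ) : ℤ) ^ k * ((3 : ℕ) : ℤ))) 1}
    (hg : g ∈ D.kolyvaginSystems (propagatedSelmerStructure W 3 k))
    {g' : Finset (HeightOneSpectrum (𝓞 ℚ)) →
      galoisCohomology (W.torsionGaloisModule (((3 : ℕ) : ℤ) ^ k' * ((3 : ℕ) : ℤ))) 1}
    (hg' : g' ∈ D'.kolyvaginSystems (propagatedSelmerStructure W 3 k'))
    (hgo' : addOrderOf g' = 3 ^ (k' + 1))
    -- Sakamoto Thm. 4.4 (2), ORDER form (R1-22, `Sakamoto2024KolyvaginFittingIdeal`), both depths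
    (hR22 : ∀ d, D.IsLevel d →
      (Nat.card (inv.dualSelmerStructure _ (D.atLevel (propagatedSelmerStructure W 3 k) d)).selmerGroup
          ∣ 3 ^ (k + 1) →
        addOrderOf (g d) * Nat.card (inv.dualSelmerStructure _
          (D.atLevel (propagatedSelmerStructure W 3 k) d)).selmerGroup = 3 ^ (k + 1)) ∧
      (3 ^ (k + 1) ∣ Nat.card (inv.dualSelmerStructure _
          (D.atLevel (propagatedSelmerStructure W 3 k) d)).selmerGroup → g d = 0))
    (hR22' : ∀ d, D'.IsLevel d →
      (Nat.card (inv'.dualSelmerStructure _ (D'.atLevel (propagatedSelmerStructure W 3 k') d)).selmerGroup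
          ∣ 3 ^ (k' + 1) →
        addOrderOf (g' d) * Nat.card (inv'.dualSelmerStructure _
          (D'.atLevel (propagatedSelmerStructure W 3 k') d)).selmerGroup = 3 ^ (k' + 1)) ∧
      (3 ^ (k' + 1) ∣ Nat.card (inv'.dualSelmerStructure _
          (D'.atLevel (propagatedSelmerStructure W 3 k') d)).selmerGroup → g' d = 0))
    -- Poitou–Tate pair counts at both depths (hypotheses; F-deep + M2′ discharge them)
    (hPT : ∀ d, D.IsLevel d →
      Nat.card (D.atLevel (propagatedSelmerStructure W 3 k) d).selmerGroup =
        3 ^ (k + 1) * Nat.card (inv.dualSelmerStructure _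
          (D.atLevel (propagatedSelmerStructure W 3 k) d)).selmerGroup)
    (hPT' : ∀ d, D'.IsLevel d →
      Nat.card (D'.atLevel (propagatedSelmerStructure W 3 k') d).selmerGroup =
        3 ^ (k' + 1) * Nat.card (inv'.dualSelmerStructure _
          (D'.atLevel (propagatedSelmerStructure W 3 k') d)).selmerGroup)
    -- Kato: `κ' = a • g`, `κu' = a' • g'`, compatible under `red` on common levels
    {a a' : ℕ}
    {κ' : Finset (HeightOneSpectrum (𝓞 ℚ)) →
      galoisCohomology (W.torsionGaloisModule (((3 : ℕ) : ℤ) ^ k * ((3 : ℕ) : ℤ))) 1}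
    {κu' : Finset (HeightOneSpectrum (𝓞 ℚ)) →
      galoisCohomology (W.torsionGaloisModule (((3 : ℕ) : ℤ) ^ k' * ((3 : ℕ) : ℤ))) 1}
    (hκ' : κ' = a • g) (hκu' : κu' = a' • g')
    (hcomp : ∀ d, D'.IsLevel d → D.IsLevel d → galoisCohomology.map red 1 (κu' d) = κ' d) :
    ∀ s, s ≤ k + 1 → (3 ^ s ∣ a ↔ 3 ^ s ∣ a') := by
  intro s hs
  haveI : Fact (Nat.Prime 3) := ⟨Nat.prime_three⟩
  have hK : D.IsKolyvaginSystem (propagatedSelmerStructure W 3 k) g :=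
    (KolyvaginDatum.mem_kolyvaginSystems_iff _ _ _).mp hg
  have hK' : D'.IsKolyvaginSystem (propagatedSelmerStructure W 3 k') g' :=
    (KolyvaginDatum.mem_kolyvaginSystems_iff _ _ _).mp hg'
  -- S2: a coordinate `d₀` where `g'` has full order `3^{k'+1}`; it is a level of `D'` and of `D`
  obtain ⟨d₀, hd₀o⟩ :=
    Ledger.exists_addOrderOf_apply_eq_pow (p := 3) g' (Nat.succ_pos k') hgo'
  have h1lt : 1 < 3 ^ (k' + 1) := Nat.one_lt_pow (Nat.succ_ne_zero k') (by norm_num)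
  have hd₀' : D'.IsLevel d₀ := by
    by_contra h
    have h0 := hK'.eq_zero_of_not_isLevel d₀ h
    rw [h0, addOrderOf_zero] at hd₀o
    omega
  have hd₀ : D.IsLevel d₀ := Set.Subset.trans hd₀' hPP
  -- the dual count at `(k', d₀)` is `1` (R1-22 at depth `k'`)
  have hN' : Nat.card (inv'.dualSelmerStructure _
      (D'.atLevel (propagatedSelmerStructure W 3 k') d₀)).selmerGroup = 1 :=
    natCard_eq_one_of_order_clauses (p := 3) (g' d₀) (Nat.succ_pos k') hd₀o
      (fun n => Subtype.ext (by
        rw [AddSubmonoidClass.coe_nsmul, ZeroMemClass.coe_zero]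
        exact galoisCohomology.nsmul_eq_zero_of_forall _
          (fun f => DiscreteGaloisModule.TateDual.nsmul_eq_zero f) n.1))
      (hR22' d₀ hd₀').1 (hR22' d₀ hd₀').2
  -- so `H' := H¹_{𝓕'(d₀)}(ℚ, E[3^{k'+1}])` has order `3^{k'+1}` and is cyclic, generated by `g' d₀`
  have hcH' : Nat.card (D'.atLevel (propagatedSelmerStructure W 3 k') d₀).selmerGroup =
      3 ^ (k' + 1) := by rw [hPT' d₀ hd₀', hN', mul_one]
  haveI hfinH' : Finite (D'.atLevel (propagatedSelmerStructure W 3 k') d₀).selmerGroup :=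
    Nat.finite_of_card_ne_zero (by rw [hcH']; positivity)
  have hg'mem : g' d₀ ∈ (D'.atLevel (propagatedSelmerStructure W 3 k') d₀).selmerGroup :=
    hK'.mem_selmerGroup d₀ hd₀'
  haveI : IsAddCyclic (D'.atLevel (propagatedSelmerStructure W 3 k') d₀).selmerGroup := by
    refine isAddCyclic_of_addOrderOf_eq_card ⟨g' d₀, hg'mem⟩ ?_
    rw [hcH', ← hd₀o, AddSubgroup.addOrderOf_mk]
  -- S3, level `k`: `incl_*` embeds `H := H¹_{𝓕(d₀)}(ℚ, E[3^{k+1}])` into `H'`, so `#N_{d₀}(k) = 1`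
  set incl := W.torsionInclusion (pow_mul_dvd_pow_mul hk) with hincl
  have hinj : Function.Injective (galoisCohomology.map incl 1) :=
    map_torsionInclusion_injective W hk (geomTorsion_eq_zero_of_fixed_of_surj W hsurj k')
  let f : (D.atLevel (propagatedSelmerStructure W 3 k) d₀).selmerGroup →+
      (D'.atLevel (propagatedSelmerStructure W 3 k') d₀).selmerGroup :=
    ((galoisCohomology.map incl 1).comp (AddSubgroup.subtype _)).codRestrict _
      (fun x => map_torsionInclusion_mem_selmerGroup_atLevel W hk D D' hT hT' x.2)
  have hf : Function.Injective f := fun x y hxy => by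
    apply Subtype.ext
    exact hinj (congrArg Subtype.val hxy)
  have hN : Nat.card (inv.dualSelmerStructure _
      (D.atLevel (propagatedSelmerStructure W 3 k) d₀)).selmerGroup = 1 :=
    eq_one_of_injective_of_isAddCyclic (p := 3) f hf
      (fun h => Subtype.ext (by
        rw [AddSubmonoidClass.coe_nsmul, ZeroMemClass.coe_zero]
        exact pow_succ_nsmul_galoisCohomology W k h.1))
      (hPT d₀ hd₀) (by norm_num)
  -- R1-22 at depth `k`: `g d₀` has full order `3^{k+1}`; `#H = 3^{k+1}`
  have hgo₀ : addOrderOf (g d₀) = 3 ^ (k + 1) := by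
    have h := (hR22 d₀ hd₀).1 (by rw [hN]; exact one_dvd _)
    rwa [hN, mul_one] at h
  have hcH : Nat.card (D.atLevel (propagatedSelmerStructure W 3 k) d₀).selmerGroup = 3 ^ (k + 1) := by
    rw [hPT d₀ hd₀, hN, mul_one]
  haveI : Finite (D.atLevel (propagatedSelmerStructure W 3 k) d₀).selmerGroup :=
    Nat.finite_of_card_ne_zero (by rw [hcH]; positivity)
  -- `red_* (g' d₀) ∈ H` is a natural multiple `w • g d₀`, and `3 ∤ w`
  have hymem : galoisCohomology.map red 1 (g' d₀) ∈
      (D.atLevel (propagatedSelmerStructure W 3 k) d₀).selmerGroup :=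
    map_red_mem_selmerGroup_atLevel W hk red hred D D' hT hT' hg'mem
  obtain ⟨w, hw⟩ := exists_nsmul_eq_of_addOrderOf_eq_natCard _ (hK.mem_selmerGroup d₀ hd₀) hymem
    (hgo₀.trans hcH.symm)
  have hw3 : ¬ 3 ∣ w := by
    refine Ledger.not_dvd_of_comp_eq_pow_nsmul (p := 3) (galoisCohomology.map incl 1) hinj
      (galoisCohomology.map red 1) (K₀ := k + 1) (r := k' - k) (Nat.succ_pos k) (g' d₀)
      (by rw [show k + 1 + (k' - k) = k' + 1 by omega]; exact hd₀o)
      (map_torsionInclusion_map_red W hk red hred (g' d₀)) (g d₀) hgo₀ w hw.symm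
  -- the compatibility `red_* (a' • g' d₀) = a • g d₀` and the scalar transport
  have hcomp₀ := hcomp d₀ hd₀' hd₀
  rw [hκu', hκ', Pi.smul_apply, Pi.smul_apply, map_nsmul, ← hw, ← mul_nsmul'] at hcomp₀
  exact Ledger.pow_dvd_iff_of_mul_nsmul_eq_nsmul (p := 3) (g d₀) hgo₀ hw3 hcomp₀ hs

end Summit.BirchSwinnertonDyer.Rank1Residual.GaloisImage.Transport

end
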